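import Summits.CriticalPhenomena.PercolationContinuityZ3.Theorems.FreeBoxPowerSaving.Negative.FreeBoxPowerSavingBounds
import Summits.CriticalPhenomena.PercolationContinuityZ3.Theses.PercFiniteBoxLRO

/-!
# Negative / tightness lemmas for the crux `FreeBoxPowerSaving` (stmt-CriticalPhenomena-4447), VI:
# linear-scale box long-range order kills every power saving

Supports (does not close) the crux `PercNonProliferation.FreeBoxPowerSaving`
(`∃ a C, 0 < a ∧ ∀ n ≥ 1, FA₂(p_c, n) ≤ C n^{-a}`).  Cross-route bridge landed from the standing
disprover's work file `Cruxes/FreeBoxPowerSaving/Disproof.lean` §12 (cdisprove cycle 3); sorry-free.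

* `fa2_mul_ge_of_boxLRO` — finite-box long-range order at linear scale, `P_p(x ↔ y in B(K n)) ≥ ρ`
  for all `x, y ∈ B(n)`, gives `FA₂(p, K n) ≥ ρ / K⁶`.
* `not_powerSaving_of_boxLRO` — hence NO power saving at such a `p` (any `K ≥ 1`, `ρ > 0`).
* `not_freeBoxPowerSaving_of_linearLRO_of_theta_pos` — **`X_D ∧ θ(p_c) > 0 ⟹ ¬ crux`**: the rank-2
  crux `PercFiniteBoxLRO.LinearScaleLROOfTheta` (stmt-CriticalPhenomena-0855, Cerf's "missing
  ingredient": `θ(p) > 0 ⟹` linear-scale box LRO) turns a discontinuity at `p_c(ℤ³)` into a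
  refutation of the crux.  Contrapositive `not_theta_pos_of_linearLRO`: **`X_D ∧ crux ⟹ θ(p_c) = 0`**
  (`θ ≥ 0`), i.e. the crux can replace the renormalisation step `RenormaliseFromLinearLRO`
  (stmt-0857, barrier `SprinklingRenormalisation`) in route `PercFiniteBoxLRO`'s assembly — a two-item
  cross-route assembly for planners; for the disproof it locates `¬ crux` exactly: a percolating `p_c`
  WITH linear box LRO (the structure of every known first-order analogue: wired FK `q ≫ 1`,
  Aizenman–Newman `1/r²`).
* `fa2_ceil_rpow_ge_of_boxLRO`, `exponent_mul_le_of_boxLRO_rpow` — box LRO at a POLYNOMIAL scale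
  `⌈n^α⌉` (`α ≥ 1`, `ρ > 0`) gives `FA₂(p, ⌈n^α⌉) ≥ (ρ/15625) n^{-6(α-1)}` and caps every power-saving
  witness at that `p` by `a ≤ 6(1 - 1/α)`; a single scale such as Cerf 2015 Thm 1.3's `α = 16`
  (`Literature.Probability.Percolation.Cerf2015_thm_1_3_three`, site version proved in tree; bond
  transcription = stmt-0860) only gives `a ≤ 45/8`, vacuous next to the unconditional DCT ceiling `a ≤ 2`.
* `not_powerSaving_of_polyBoxLRO`, `not_freeBoxPowerSaving_of_polyLRO_of_theta_pos`,
  `not_theta_pos_of_polyLRO` — but LRO at EVERY polynomial scale kills it: **`PolyScaleLROOfTheta`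
  (stmt-CriticalPhenomena-0858, `∀ α > 1`) `∧ θ(p_c) > 0 ⟹ ¬ crux`**, since `6(1 - 1/α) → 0` as
  `α → 1⁺`; equivalently `0858 ∧ crux ⟹ θ(p_c) = 0`.  So the crux pairs with the WEAKER rank-4 item of
  route `PercFiniteBoxLRO` (its `α → 1⁺` tail), not only with `X_D`.
-/

namespace Summit.CriticalPhenomena.PercolationContinuityZ3.FreeBoxPowerSavingNegative

open MeasureTheory ProbabilityTheory Filter
open Literature.Probability.Percolation Literature.Probability.LatticeModels
open Summit.CriticalPhenomena.PercolationContinuityZ3.Theses.PercNonProliferation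
open Summit.CriticalPhenomena.PercolationContinuityZ3.Theses.PercFiniteBoxLRO (LinearScaleLROOfTheta
  PolyScaleLROOfTheta)
open scoped BigOperators Topology

noncomputable section

/-- `|B(K n)| ≤ K³ |B(n)|` for `K ≥ 1` (as reals): `2Kn + 1 ≤ K(2n+1)`. -/
theorem card_box_mul_le {K : ℕ} (hK : 1 ≤ K) (n : ℕ) :
    ((box 3 (K * n)).card : ℝ) ≤ (K : ℝ) ^ 3 * ((box 3 n).card : ℝ) := by
  rw [card_box_real, card_box_real]
  have hK1 : (1 : ℝ) ≤ K := by exact_mod_cast hK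
  have hn0 : (0 : ℝ) ≤ n := Nat.cast_nonneg n
  have h : 2 * ((K * n : ℕ) : ℝ) + 1 ≤ K * (2 * (n : ℝ) + 1) := by push_cast; nlinarith
  calc (2 * ((K * n : ℕ) : ℝ) + 1) ^ 3 ≤ ((K : ℝ) * (2 * (n : ℝ) + 1)) ^ 3 := by
        gcongr
    _ = (K : ℝ) ^ 3 * (2 * (n : ℝ) + 1) ^ 3 := by ring

/-- **Box long-range order bounds `FA₂` below**: if `P_p(x ↔ y in B(K n)) ≥ ρ` for all
`x, y ∈ B(n)` (`K ≥ 1`), then `FA₂(p, K n) ≥ ρ / K⁶`. -/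
theorem fa2_mul_ge_of_boxLRO {p : unitInterval} {ρ : ℝ} {K n : ℕ} (hK : 1 ≤ K)
    (h : ∀ x ∈ box 3 n, ∀ y ∈ box 3 n,
      ρ ≤ (bondPercolation (zdGraph 3) p).real (openConnIn ↑(box 3 (K * n)) x y)) :
    ρ / (K : ℝ) ^ 6 ≤ fa2 p (K * n) := by
  have hsub : box 3 n ⊆ box 3 (K * n) := box_mono 3 (Nat.le_mul_of_pos_left n hK)
  have hcK := card_box_pos (K * n)
  have hKpos : (0 : ℝ) < K := by exact_mod_cast hK
  -- a negative `ρ` is trivial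
  rcases lt_or_ge ρ 0 with hρneg | hρ
  · exact le_trans (div_neg_of_neg_of_pos hρneg (pow_pos hKpos 6)).le (fa2_nonneg p _)
  -- `ρ |B(n)|² ≤ pairSum p (K n)`
  have hps : ρ * ((box 3 n).card : ℝ) ^ 2 ≤ pairSum p (K * n) := by
    unfold pairSum
    calc ρ * ((box 3 n).card : ℝ) ^ 2 = ∑ _x ∈ box 3 n, ∑ _y ∈ box 3 n, ρ := by
          rw [Finset.sum_const, Finset.sum_const, nsmul_eq_mul, nsmul_eq_mul]; ring
      _ ≤ ∑ x ∈ box 3 n, ∑ y ∈ box 3 n,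
            (bondPercolation (zdGraph 3) p).real (openConnIn ↑(box 3 (K * n)) x y) :=
          Finset.sum_le_sum fun x hx => Finset.sum_le_sum fun y hy => h x hx y hy
      _ ≤ ∑ x ∈ box 3 n, ∑ y ∈ box 3 (K * n),
            (bondPercolation (zdGraph 3) p).real (openConnIn ↑(box 3 (K * n)) x y) :=
          Finset.sum_le_sum fun x _ =>
            Finset.sum_le_sum_of_subset_of_nonneg hsub fun _ _ _ => measureReal_nonneg
      _ ≤ ∑ x ∈ box 3 (K * n), ∑ y ∈ box 3 (K * n),
            (bondPercolation (zdGraph 3) p).real (openConnIn ↑(box 3 (K * n)) x y) :=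
          Finset.sum_le_sum_of_subset_of_nonneg hsub fun _ _ _ =>
            Finset.sum_nonneg fun _ _ => measureReal_nonneg
  -- `|B(K n)|² ≤ K⁶ |B(n)|²`
  have hcard : ((box 3 (K * n)).card : ℝ) ^ 2 ≤ (K : ℝ) ^ 6 * ((box 3 n).card : ℝ) ^ 2 := by
    calc ((box 3 (K * n)).card : ℝ) ^ 2 ≤ ((K : ℝ) ^ 3 * ((box 3 n).card : ℝ)) ^ 2 :=
          pow_le_pow_left₀ hcK.le (card_box_mul_le hK n) 2
      _ = (K : ℝ) ^ 6 * ((box 3 n).card : ℝ) ^ 2 := by ring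
  unfold fa2
  rw [div_le_div_iff₀ (pow_pos hKpos 6) (pow_pos hcK 2)]
  calc ρ * ((box 3 (K * n)).card : ℝ) ^ 2 ≤ ρ * ((K : ℝ) ^ 6 * ((box 3 n).card : ℝ) ^ 2) :=
        mul_le_mul_of_nonneg_left hcard hρ
    _ = ρ * ((box 3 n).card : ℝ) ^ 2 * (K : ℝ) ^ 6 := by ring
    _ ≤ pairSum p (K * n) * (K : ℝ) ^ 6 :=
        mul_le_mul_of_nonneg_right hps (pow_pos hKpos 6).le

/-- **Linear-scale box LRO at `p` ⟹ no power saving at `p`** (any witness `ρ > 0`, `K`; `K = 0` is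
impossible since `B(0) = {0}` cannot contain `B(1)`). -/
theorem not_powerSaving_of_boxLRO {p : unitInterval} {ρ : ℝ} (hρ : 0 < ρ) {K : ℕ}
    (h : ∀ n : ℕ, 1 ≤ n → ∀ x ∈ box 3 n, ∀ y ∈ box 3 n,
      ρ ≤ (bondPercolation (zdGraph 3) p).real (openConnIn ↑(box 3 (K * n)) x y)) :
    ¬ ∃ a C : ℝ, 0 < a ∧ ∀ n : ℕ, 1 ≤ n → fa2 p n ≤ C * (n : ℝ) ^ (-a) := by
  rcases Nat.eq_zero_or_pos K with rfl | hKpos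
  · -- `K = 0`: the event `{v ↔ v in B(0)}` is empty for `v = (1,1,1) ∉ B(0)`
    exfalso
    set v : Site 3 := fun _ => 1 with hv
    have hv1 : v ∈ box 3 1 := by
      rw [mem_box]; intro i; simp [hv]
    have hv0 : v ∉ box 3 (0 * 1) := by
      rw [mem_box]; push_cast
      intro hcon
      have := (hcon 0).2
      simp [hv] at this
    have hempty : (openConnIn (↑(box 3 (0 * 1)) : Set (Site 3)) v v) = ∅ := by
      ext ω
      simp only [Set.mem_empty_iff_false, iff_false]
      rintro ⟨hx, -, -⟩
      exact hv0 (Finset.mem_coe.1 hx)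
    have h1 := h 1 le_rfl v hv1 v hv1
    rw [hempty, measureReal_empty] at h1
    linarith
  · rintro ⟨a, C, ha, hC⟩
    have hK : 1 ≤ K := hKpos
    have hKr : (0 : ℝ) < K := by exact_mod_cast hKpos
    -- along `N = K n`: `ρ / K⁶ ≤ fa2 p (K n) ≤ C (K n)^{-a} → 0`
    have hKn : Tendsto (fun n : ℕ => K * n) atTop atTop :=
      tendsto_atTop_mono (fun n => Nat.le_mul_of_pos_left n hKpos) tendsto_id
    have hT : Tendsto (fun n : ℕ => C * (((K * n : ℕ) : ℝ)) ^ (-a)) atTop (𝓝 0) := by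
      have := ((tendsto_rpow_neg_atTop ha).comp (tendsto_natCast_atTop_atTop.comp hKn)).const_mul C
      simpa using this
    have hev : ∀ᶠ n : ℕ in atTop, C * (((K * n : ℕ) : ℝ)) ^ (-a) < ρ / (K : ℝ) ^ 6 :=
      hT.eventually (eventually_lt_nhds (div_pos hρ (pow_pos hKr 6)))
    obtain ⟨n, hn, hn1⟩ := (hev.and (eventually_ge_atTop 1)).exists
    have hKn1 : 1 ≤ K * n := le_trans hn1 (Nat.le_mul_of_pos_left n hKpos)
    have h1 : ρ / (K : ℝ) ^ 6 ≤ fa2 p (K * n) := fa2_mul_ge_of_boxLRO hK (h n hn1)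
    have h2 : fa2 p (K * n) ≤ C * (((K * n : ℕ) : ℝ)) ^ (-a) := hC (K * n) hKn1
    linarith

/-- **`X_D ∧ θ(p_c) > 0 ⟹ ¬ FreeBoxPowerSaving`**: linear-scale box long-range order from
`θ > 0` (the crux `LinearScaleLROOfTheta` of route `PercFiniteBoxLRO`, stmt-CriticalPhenomena-0855)
and a discontinuous transition at `p_c(ℤ³)` together refute the crux. -/
theorem not_freeBoxPowerSaving_of_linearLRO_of_theta_pos (hX : LinearScaleLROOfTheta)
    (hθ : 0 < theta (zdGraph 3) (0 : Site 3) (criticalProbI 3)) : ¬ FreeBoxPowerSaving := by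
  obtain ⟨ρ, hρ, K, hK⟩ := hX (criticalProbI 3) hθ
  rw [freeBoxPowerSaving_iff_fa2]
  exact not_powerSaving_of_boxLRO hρ hK

/-- **`X_D ∧ FreeBoxPowerSaving ⟹ ¬ (θ(p_c) > 0)`**, i.e. `θ(p_c(ℤ³)) = 0` since `θ ≥ 0`: modulo
the linear-scale LRO crux of route `PercFiniteBoxLRO`, the present crux is summit-strength (it can
stand in for that route's renormalisation step `RenormaliseFromLinearLRO`). -/
theorem not_theta_pos_of_linearLRO (hX : LinearScaleLROOfTheta) (h : FreeBoxPowerSaving) :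
    ¬ 0 < theta (zdGraph 3) (0 : Site 3) (criticalProbI 3) :=
  fun hθ => not_freeBoxPowerSaving_of_linearLRO_of_theta_pos hX hθ h

/-! ## Polynomial scales: LRO inside `B(⌈n^α⌉)` caps the exponent by `6(1 - 1/α)`; all `α > 1` kill it -/

/-- **Box LRO at a polynomial scale bounds `FA₂` below**: if `P_p(x ↔ y in B(⌈n^α⌉)) ≥ ρ` for all
`x, y ∈ B(n)` (`α ≥ 1`, `n ≥ 1`), then `FA₂(p, ⌈n^α⌉) ≥ (ρ / 15625) · n^{-6(α-1)}`. -/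
theorem fa2_ceil_rpow_ge_of_boxLRO {p : unitInterval} {ρ α : ℝ} (hα : 1 ≤ α) {n : ℕ} (hn : 1 ≤ n)
    (h : ∀ x ∈ box 3 n, ∀ y ∈ box 3 n,
      ρ ≤ (bondPercolation (zdGraph 3) p).real (openConnIn ↑(box 3 ⌈(n : ℝ) ^ α⌉₊) x y)) :
    ρ / 15625 * (n : ℝ) ^ (-(6 * (α - 1))) ≤ fa2 p ⌈(n : ℝ) ^ α⌉₊ := by
  set m : ℕ := ⌈(n : ℝ) ^ α⌉₊ with hm
  have hn1 : (1 : ℝ) ≤ n := by exact_mod_cast hn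
  have hnpos : (0 : ℝ) < n := by linarith
  have hnα1 : (1 : ℝ) ≤ (n : ℝ) ^ α := Real.one_le_rpow hn1 (by linarith)
  have hnα : (n : ℝ) ≤ (n : ℝ) ^ α := by
    calc (n : ℝ) = (n : ℝ) ^ (1 : ℝ) := (Real.rpow_one _).symm
      _ ≤ (n : ℝ) ^ α := Real.rpow_le_rpow_of_exponent_le hn1 hα
  have hmα : (n : ℝ) ^ α ≤ (m : ℝ) := Nat.le_ceil _
  have hm_le : (m : ℝ) ≤ (n : ℝ) ^ α + 1 := (Nat.ceil_lt_add_one (by linarith)).le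
  have hnm : n ≤ m := by exact_mod_cast hnα.trans hmα
  have hsub : box 3 n ⊆ box 3 m := box_mono 3 hnm
  have hcm := card_box_pos m
  have hpow_pos : 0 < (n : ℝ) ^ (-(6 * (α - 1))) := Real.rpow_pos_of_pos hnpos _
  -- a negative `ρ` is trivial
  rcases lt_or_ge ρ 0 with hρneg | hρ
  · have : ρ / 15625 * (n : ℝ) ^ (-(6 * (α - 1))) < 0 :=
      mul_neg_of_neg_of_pos (div_neg_of_neg_of_pos hρneg (by norm_num)) hpow_pos
    exact this.le.trans (fa2_nonneg p _)
  -- `ρ |B(n)|² ≤ pairSum p m`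
  have hps : ρ * ((box 3 n).card : ℝ) ^ 2 ≤ pairSum p m := by
    unfold pairSum
    calc ρ * ((box 3 n).card : ℝ) ^ 2 = ∑ _x ∈ box 3 n, ∑ _y ∈ box 3 n, ρ := by
          rw [Finset.sum_const, Finset.sum_const, nsmul_eq_mul, nsmul_eq_mul]; ring
      _ ≤ ∑ x ∈ box 3 n, ∑ y ∈ box 3 n,
            (bondPercolation (zdGraph 3) p).real (openConnIn ↑(box 3 m) x y) :=
          Finset.sum_le_sum fun x hx => Finset.sum_le_sum fun y hy => h x hx y hy
      _ ≤ ∑ x ∈ box 3 n, ∑ y ∈ box 3 m,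
            (bondPercolation (zdGraph 3) p).real (openConnIn ↑(box 3 m) x y) :=
          Finset.sum_le_sum fun x _ =>
            Finset.sum_le_sum_of_subset_of_nonneg hsub fun _ _ _ => measureReal_nonneg
      _ ≤ ∑ x ∈ box 3 m, ∑ y ∈ box 3 m,
            (bondPercolation (zdGraph 3) p).real (openConnIn ↑(box 3 m) x y) :=
          Finset.sum_le_sum_of_subset_of_nonneg hsub fun _ _ _ =>
            Finset.sum_nonneg fun _ _ => measureReal_nonneg
  -- `|B(m)|² ≤ 15625 n^{6α}` and `n⁶ ≤ |B(n)|²`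
  have hcardm : ((box 3 m).card : ℝ) ^ 2 ≤ 15625 * (n : ℝ) ^ (6 * α) := by
    rw [card_box_real]
    have h5 : 2 * (m : ℝ) + 1 ≤ 5 * (n : ℝ) ^ α := by linarith
    have h6 : ((n : ℝ) ^ α) ^ 6 = (n : ℝ) ^ (6 * α) := by
      rw [← Real.rpow_natCast ((n : ℝ) ^ α) 6, ← Real.rpow_mul hnpos.le]
      congr 1; push_cast; ring
    calc ((2 * (m : ℝ) + 1) ^ 3) ^ 2 = (2 * (m : ℝ) + 1) ^ 6 := by ring
      _ ≤ (5 * (n : ℝ) ^ α) ^ 6 := by gcongr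
      _ = 15625 * ((n : ℝ) ^ α) ^ 6 := by ring
      _ = 15625 * (n : ℝ) ^ (6 * α) := by rw [h6]
  have hcardn : (n : ℝ) ^ 6 ≤ ((box 3 n).card : ℝ) ^ 2 := by
    rw [card_box_real]
    have : (n : ℝ) ≤ 2 * n + 1 := by linarith
    calc (n : ℝ) ^ 6 = ((n : ℝ) ^ 3) ^ 2 := by ring
      _ ≤ ((2 * (n : ℝ) + 1) ^ 3) ^ 2 := by gcongr
  have hsplit : (n : ℝ) ^ (-(6 * (α - 1))) * (n : ℝ) ^ (6 * α) = (n : ℝ) ^ 6 := by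
    rw [← Real.rpow_add hnpos, ← Real.rpow_natCast (n : ℝ) 6]
    congr 1; push_cast; ring
  unfold fa2
  rw [le_div_iff₀ (pow_pos hcm 2)]
  calc ρ / 15625 * (n : ℝ) ^ (-(6 * (α - 1))) * ((box 3 m).card : ℝ) ^ 2
      ≤ ρ / 15625 * (n : ℝ) ^ (-(6 * (α - 1))) * (15625 * (n : ℝ) ^ (6 * α)) :=
        mul_le_mul_of_nonneg_left hcardm (mul_nonneg (div_nonneg hρ (by norm_num)) hpow_pos.le)
    _ = ρ * ((n : ℝ) ^ (-(6 * (α - 1))) * (n : ℝ) ^ (6 * α)) := by ring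
    _ = ρ * (n : ℝ) ^ 6 := by rw [hsplit]
    _ ≤ ρ * ((box 3 n).card : ℝ) ^ 2 := mul_le_mul_of_nonneg_left hcardn hρ
    _ ≤ pairSum p m := hps

/-- **Quantitative ceiling from polynomial-scale LRO**: box LRO at scale `⌈n^α⌉` with `ρ > 0`, `α ≥ 1`
(e.g. Cerf 2015 Thm 1.3 at a percolating `p`: `α = 16`) forces every power-saving witness `(a, C)`
at that `p` to satisfy `a α ≤ 6(α - 1)`, i.e. `a ≤ 6(1 - 1/α)`. -/
theorem exponent_mul_le_of_boxLRO_rpow {p : unitInterval} {ρ α : ℝ} (hα : 1 ≤ α) (hρ : 0 < ρ)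
    (h : ∀ n : ℕ, 1 ≤ n → ∀ x ∈ box 3 n, ∀ y ∈ box 3 n,
      ρ ≤ (bondPercolation (zdGraph 3) p).real (openConnIn ↑(box 3 ⌈(n : ℝ) ^ α⌉₊) x y))
    {a C : ℝ} (hC : ∀ n : ℕ, 1 ≤ n → fa2 p n ≤ C * (n : ℝ) ^ (-a)) : a * α ≤ 6 * (α - 1) := by
  by_contra hlt
  push Not at hlt
  have he : 0 < a * α - 6 * (α - 1) := by linarith
  have hC0 : 0 ≤ C := by
    have := (fa2_nonneg p 1).trans (hC 1 le_rfl)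
    simpa using this
  -- `C n^{-(aα - 6(α-1))} → 0`, so eventually `< ρ / 15625`
  have hT : Tendsto (fun n : ℕ => C * (n : ℝ) ^ (-(a * α - 6 * (α - 1)))) atTop (𝓝 0) := by
    have := ((tendsto_rpow_neg_atTop he).comp tendsto_natCast_atTop_atTop).const_mul C
    simpa using this
  have hev : ∀ᶠ n : ℕ in atTop, C * (n : ℝ) ^ (-(a * α - 6 * (α - 1))) < ρ / 15625 :=
    hT.eventually (eventually_lt_nhds (by positivity))
  obtain ⟨n, hn, hn1⟩ := (hev.and (eventually_ge_atTop 1)).exists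
  have hn1' : (1 : ℝ) ≤ n := by exact_mod_cast hn1
  have hnpos : (0 : ℝ) < n := by linarith
  set m : ℕ := ⌈(n : ℝ) ^ α⌉₊ with hm
  have hnα1 : (1 : ℝ) ≤ (n : ℝ) ^ α := Real.one_le_rpow hn1' (by linarith)
  have hnα_pos : 0 < (n : ℝ) ^ α := by linarith
  have hmα : (n : ℝ) ^ α ≤ (m : ℝ) := Nat.le_ceil _
  have hm1 : 1 ≤ m := by exact_mod_cast hnα1.trans hmα
  have h1 := fa2_ceil_rpow_ge_of_boxLRO hα hn1 (h n hn1)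
  have h2 : fa2 p m ≤ C * (m : ℝ) ^ (-a) := hC m hm1
  have ha0 : 0 ≤ a := by
    -- `a < 0` would contradict `hlt` since `α ≥ 1`: `a α < 0 ≤ 6(α-1)`; so `a ≥ 0`
    by_contra ha
    push Not at ha
    have : a * α < 0 := mul_neg_of_neg_of_pos ha (by linarith)
    linarith
  have h3 : C * (m : ℝ) ^ (-a) ≤ C * ((n : ℝ) ^ α) ^ (-a) :=
    mul_le_mul_of_nonneg_left (Real.rpow_le_rpow_of_nonpos hnα_pos hmα (by linarith)) hC0
  have h4 : ((n : ℝ) ^ α) ^ (-a) = (n : ℝ) ^ (-(a * α - 6 * (α - 1))) * (n : ℝ) ^ (-(6 * (α - 1))) := by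
    rw [← Real.rpow_mul hnpos.le, ← Real.rpow_add hnpos]
    congr 1; ring
  have key : ρ / 15625 * (n : ℝ) ^ (-(6 * (α - 1))) ≤
      C * (n : ℝ) ^ (-(a * α - 6 * (α - 1))) * (n : ℝ) ^ (-(6 * (α - 1))) := by
    calc _ ≤ fa2 p m := h1
      _ ≤ C * (m : ℝ) ^ (-a) := h2
      _ ≤ C * ((n : ℝ) ^ α) ^ (-a) := h3
      _ = _ := by rw [h4, mul_assoc]
  have hpos : 0 < (n : ℝ) ^ (-(6 * (α - 1))) := Real.rpow_pos_of_pos hnpos _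
  have := le_of_mul_le_mul_right key hpos
  linarith

/-- **LRO at every polynomial scale ⟹ no power saving**: if for every `α > 1` there is `ρ_α > 0`
with `P_p(x ↔ y in B(⌈n^α⌉)) ≥ ρ_α` for all `n ≥ 1`, `x, y ∈ B(n)`, then `FA₂(p, ·)` has no power
saving (take `α = 12/(12 - a)`: then `a α = 12a/(12-a) > 6a/(12-a) = 6(α - 1)`). -/
theorem not_powerSaving_of_polyBoxLRO {p : unitInterval}
    (h : ∀ α : ℝ, 1 < α → ∃ ρ : ℝ, 0 < ρ ∧ ∀ n : ℕ, 1 ≤ n → ∀ x ∈ box 3 n, ∀ y ∈ box 3 n,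
      ρ ≤ (bondPercolation (zdGraph 3) p).real (openConnIn ↑(box 3 ⌈(n : ℝ) ^ α⌉₊) x y)) :
    ¬ ∃ a C : ℝ, 0 < a ∧ ∀ n : ℕ, 1 ≤ n → fa2 p n ≤ C * (n : ℝ) ^ (-a) := by
  rintro ⟨a, C, ha, hC⟩
  have ha3 : a ≤ 3 := exponent_le_three p hC
  have h12 : 0 < 12 - a := by linarith
  have h12ne : (12 - a) ≠ 0 := h12.ne'
  set α : ℝ := 12 / (12 - a) with hαdef
  have hα1 : 1 < α := by
    rw [hαdef, lt_div_iff₀ h12]; linarith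
  obtain ⟨ρ, hρ, hlro⟩ := h α hα1
  have hle := exponent_mul_le_of_boxLRO_rpow hα1.le hρ hlro hC
  -- `a α = 12a/(12 - a)` and `6(α - 1) = 6a/(12 - a)`: contradiction with `a > 0`
  have h1 : a * α = 12 * a / (12 - a) := by rw [hαdef]; ring
  have h2 : 6 * (α - 1) = 6 * a / (12 - a) := by
    rw [hαdef]; field_simp; ring
  rw [h1, h2, div_le_div_iff_of_pos_right h12] at hle
  linarith

/-- **`PolyScaleLROOfTheta ∧ θ(p_c) > 0 ⟹ ¬ FreeBoxPowerSaving`**: already box LRO at EVERY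
polynomial scale `⌈n^α⌉`, `α > 1` (route `PercFiniteBoxLRO`'s rank-4 crux, stmt-CriticalPhenomena-0858
— its `α → 1⁺` tail), from a discontinuity at `p_c(ℤ³)`, refutes the crux.  (A single `α`, e.g. Cerf's
proved `α = 16`, only caps the exponent: `a ≤ 6(1 - 1/α)`, `exponent_mul_le_of_boxLRO_rpow`.) -/
theorem not_freeBoxPowerSaving_of_polyLRO_of_theta_pos (hP : PolyScaleLROOfTheta)
    (hθ : 0 < theta (zdGraph 3) (0 : Site 3) (criticalProbI 3)) : ¬ FreeBoxPowerSaving := by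
  rw [freeBoxPowerSaving_iff_fa2]
  exact not_powerSaving_of_polyBoxLRO fun α hα => hP α hα (criticalProbI 3) hθ

/-- **`PolyScaleLROOfTheta ∧ FreeBoxPowerSaving ⟹ ¬ (θ(p_c) > 0)`** (`= θ(p_c) = 0`). -/
theorem not_theta_pos_of_polyLRO (hP : PolyScaleLROOfTheta) (h : FreeBoxPowerSaving) :
    ¬ 0 < theta (zdGraph 3) (0 : Site 3) (criticalProbI 3) :=
  fun hθ => not_freeBoxPowerSaving_of_polyLRO_of_theta_pos hP hθ h

end

end Summit.CriticalPhenomena.PercolationContinuityZ3.FreeBoxPowerSavingNegative
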